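import Summits.QuantumFields.YangMills.Theorems.LangevinControlUVOSLegsFromFemtoAndGapDefs
import Literature.MathematicalPhysics.QuantumFieldTheory.GaugeOSData
import HarnessLib

/-!
# The volume-free (infinite-volume) forms of the non-triviality floors `LowerBounds` — definitions

HONEST FRAMING (R136 (i) «parallel continuum programme», seat `ym-infvol-p1`, pre-birth vocabulary for the
infinite-volume ∕ continuum-from-UV route; bears on the spine route `BalabanLadder`: crux `NT` = stmt-QuantumFields-19353
and crux `UVSeamRec` = stmt-QuantumFields-20043, whose conclusions carry `LowerBounds G r a` — the k-free lattice lower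
bounds on the reflection-paired smeared truncated two-point function `Q2` and the smeared connected three-point function
`Q3` of the action density on large odd TORI).  DEFINITIONS ONLY, nothing asserted: each `def` below is the
infinite-volume READING of a piece of `DlrCollarTransfer.LowerBounds` — a statement a route item or registered stub proves
or consumes, not a literature fact and not a restatement of a crux as a claim.  Conditional currency (the floors are
dimensional transmutation, barrier `PerturbativeInvisibility`); existence half of the continuum programme only; not a
gap, not Clay.

WHY.  `LowerBounds G r a` (Theorems/LangevinControlUVOSLegsFromFemtoAndGapDefs §1) gives `ε ≤ Q2_(β,L,a β)(θv, v)` and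
`ε ≤ |Q3_(β,L,a β)(f, g, h)|` on every odd torus `(ℤ/(2L+1))⁴` with `a β · L ≥ Λ₅` — uniform in the volume beyond a
physical-size threshold.  A route taking the thermodynamic limit first reads the same floors in STATES ON `ℤ⁴`: the
torus sums over `box 4 L × box 4 L` become sums over `ℤ⁴ × ℤ⁴` (absolutely convergent: Schwartz weights, bounded
covariances) and the volume threshold disappears.  This file names that reading; the passage
`LowerBounds ⇒ LowerBoundsTL` (Tannery's theorem along the torus-projective family) is the companion proof file
`BalabanLadderInfVolFloors.lean`.

* `stateCov G r μ x y`, `stateK3 G r μ x y z` — covariance and third cumulant of the action densities `dens` in a state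
  `μ` on `ℤ⁴` gauge fields (`torusE` ↦ `∫ · dμ` in the torus quantities of `DlrCollarTransfer`).
* `Q2State G r μ s f g`, `Q3State G r μ s f g h` — the smeared truncated two-point ∕ connected three-point functions at
  spacing `s` in the state `μ`, as unconditional sums over `ℤ⁴ × ℤ⁴` ∕ `ℤ⁴ × ℤ⁴ × ℤ⁴` (`box 4 L` ↦ `ℤ⁴` in `Q2` ∕ `Q3`).
* `LowerBoundsOn G r a S` — the floors for a `β`-indexed family of states `S β` (no volume threshold); `LowerBoundsTL`
  (`S = oddTorusLimitPoints r`), `LowerBoundsIV` (`infiniteVolumeLimitPoints r.ρ`), `LowerBoundsDLR` (`ymGibbsMeasures`).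

References: K. Osterwalder, E. Seiler, Ann. Phys. 110 (1978) §2; A. Jaffe, E. Witten (2006) §5–§6; E. Seiler, LNP 159
(1982) Ch. 2; tree files above.
-/

set_option autoImplicit false

noncomputable section

open MeasureTheory
open scoped BigOperators SchwartzMap
open Literature.MathematicalPhysics.QuantumFieldTheory Literature.MathematicalPhysics.QuantumLattice
open Literature.Probability.LatticeModels (Site)
open Summit.QuantumFields.YangMills.Cruxes.OSLegsFromFemtoAndGap.DlrCollarTransfer

namespace Summit.QuantumFields.YangMills.Theorems.InfiniteVolume

variable (G : Type) [Group G] [TopologicalSpace G] [IsTopologicalGroup G] [CompactSpace G]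
  [MeasurableSpace G] [BorelSpace G] (r : LatticeRep G) (a : ℝ → ℝ)

/-- **Covariance of the action densities** `dens x`, `dens y` in a state `μ` on `ℤ⁴` gauge fields:
`∫ AₓA_y dμ − ∫ Aₓ dμ ∫ A_y dμ` (the torus quantity inside `DlrCollarTransfer.Q2` with `torusE` ↦ `∫ · dμ`). -/
def stateCov (μ : Measure (LGConfig 4 G)) (x y : Site 4) : ℝ :=
  (∫ U, dens G r x U * dens G r y U ∂μ) - (∫ U, dens G r x U ∂μ) * ∫ U, dens G r y U ∂μ

/-- **Third cumulant of the action densities** at `x, y, z` in a state `μ` (verbatim the combination of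
`DlrCollarTransfer.torusK3` ∕ `OSData.IsNonGaussian` with `torusE` ↦ `∫ · dμ`). -/
def stateK3 (μ : Measure (LGConfig 4 G)) (x y z : Site 4) : ℝ :=
  (∫ U, dens G r x U * dens G r y U * dens G r z U ∂μ)
    - (∫ U, dens G r x U ∂μ) * (∫ U, dens G r y U * dens G r z U ∂μ)
    - (∫ U, dens G r y U ∂μ) * (∫ U, dens G r x U * dens G r z U ∂μ)
    - (∫ U, dens G r z U ∂μ) * (∫ U, dens G r x U * dens G r y U ∂μ)
    + 2 * ((∫ U, dens G r x U ∂μ) * (∫ U, dens G r y U ∂μ) * ∫ U, dens G r z U ∂μ)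

/-- **Smeared truncated two-point function at spacing `s` in the state `μ`**:
`Σ_{x,y ∈ ℤ⁴} f(s x) g(s y) Cov_μ(Aₓ, A_y)` — `DlrCollarTransfer.Q2` with the torus box replaced by `ℤ⁴` and the torus
state by `μ` (unconditional sum over `ℤ⁴ × ℤ⁴`; absolutely convergent for Schwartz `f, g`, `s > 0` and a probability
measure `μ`, see the companion proof file). -/
def Q2State (μ : Measure (LGConfig 4 G)) (s : ℝ) (f g : 𝓢(EuclideanSpace ℝ (Fin 4), ℝ)) : ℝ :=
  ∑' p : Site 4 × Site 4, f (s • siteToE p.1) * g (s • siteToE p.2) * stateCov G r μ p.1 p.2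

/-- **Smeared connected three-point function at spacing `s` in the state `μ`**:
`Σ_{x,y,z ∈ ℤ⁴} f(s x) g(s y) h(s z) κ₃^μ(Aₓ, A_y, A_z)` — `DlrCollarTransfer.Q3` read in `μ` over `ℤ⁴ × ℤ⁴ × ℤ⁴`. -/
def Q3State (μ : Measure (LGConfig 4 G)) (s : ℝ) (f g h : 𝓢(EuclideanSpace ℝ (Fin 4), ℝ)) : ℝ :=
  ∑' p : Site 4 × Site 4 × Site 4,
    f (s • siteToE p.1) * g (s • siteToE p.2.1) * h (s • siteToE p.2.2) * stateK3 G r μ p.1 p.2.1 p.2.2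

/-- **`LowerBoundsOn G r a S` — the volume-free (infinite-volume) form of `LowerBounds` for a `β`-indexed family of
states `S β` on `ℤ⁴` gauge fields.**  (i) ONE real Schwartz function `v` supported in positive time and `ε > 0`, `β₅`
with `ε ≤ Q2State μ (a β) (θv) v` for all `β ≥ β₅` and every `μ ∈ S β`; (ii) THREE real Schwartz functions with pairwise
disjoint supports and `ε > 0`, `β₅` with `ε ≤ |Q3State μ (a β) f g h|` likewise.  Verbatim `DlrCollarTransfer.LowerBounds`
with the torus quantities replaced by their readings in `μ` and NO volume threshold `Λ₅` (the thermodynamic limit has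
been taken). -/
def LowerBoundsOn (S : ℝ → Set (Measure (LGConfig 4 G))) : Prop :=
  (∃ (v : 𝓢(EuclideanSpace ℝ (Fin 4), ℝ)) (ε β₅ : ℝ), tsupport v ⊆ {y : EuclideanSpace ℝ (Fin 4) | 0 < y 0} ∧ 0 < ε ∧
      ∀ β : ℝ, β₅ ≤ β → ∀ μ ∈ S β, ε ≤ Q2State G r μ (a β) (thetaTest 4 v) v) ∧
    (∃ (f g h : 𝓢(EuclideanSpace ℝ (Fin 4), ℝ)) (ε β₅ : ℝ), Disjoint (tsupport f) (tsupport g) ∧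
      Disjoint (tsupport g) (tsupport h) ∧ Disjoint (tsupport f) (tsupport h) ∧ 0 < ε ∧
      ∀ β : ℝ, β₅ ≤ β → ∀ μ ∈ S β, ε ≤ |Q3State G r μ (a β) f g h|)

/-- **`LowerBoundsTL`** — the floors for the ODD-TORUS THERMODYNAMIC LIMIT STATES `oddTorusLimitPoints r β`; implied by
`LowerBounds G r a` for a positive unit map (companion file, `lowerBoundsTL_of_lowerBounds`). -/
def LowerBoundsTL : Prop :=
  LowerBoundsOn G r a (oddTorusLimitPoints r)

/-- **`LowerBoundsIV`** — the floors for ALL TORUS LIMIT STATES `infiniteVolumeLimitPoints r.ρ β`. -/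
def LowerBoundsIV : Prop :=
  LowerBoundsOn G r a (infiniteVolumeLimitPoints (d := 4) r.ρ)

/-- **`LowerBoundsDLR`** — the floors for EVERY DLR STATE `ymGibbsMeasures r.ρ β` (the strongest form; not implied by
torus data). -/
def LowerBoundsDLR : Prop :=
  LowerBoundsOn G r a (ymGibbsMeasures (d := 4) r.ρ)

/-- `Q2State` unfolded (the summand, for citation). [folklore] -/
theorem q2State_eq (μ : Measure (LGConfig 4 G)) (s : ℝ) (f g : 𝓢(EuclideanSpace ℝ (Fin 4), ℝ)) :
    Q2State G r μ s f g = ∑' p : Site 4 × Site 4, f (s • siteToE p.1) * g (s • siteToE p.2) *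
      ((∫ U, dens G r p.1 U * dens G r p.2 U ∂μ) - (∫ U, dens G r p.1 U ∂μ) * ∫ U, dens G r p.2 U ∂μ) :=
  rfl

/-- `LowerBoundsTL` unfolded to the level of `oddTorusLimitPoints`. [folklore] -/
theorem lowerBoundsTL_iff :
    LowerBoundsTL G r a ↔
      (∃ (v : 𝓢(EuclideanSpace ℝ (Fin 4), ℝ)) (ε β₅ : ℝ), tsupport v ⊆ {y : EuclideanSpace ℝ (Fin 4) | 0 < y 0} ∧
          0 < ε ∧ ∀ β : ℝ, β₅ ≤ β → ∀ μ ∈ oddTorusLimitPoints r β, ε ≤ Q2State G r μ (a β) (thetaTest 4 v) v) ∧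
        (∃ (f g h : 𝓢(EuclideanSpace ℝ (Fin 4), ℝ)) (ε β₅ : ℝ), Disjoint (tsupport f) (tsupport g) ∧
          Disjoint (tsupport g) (tsupport h) ∧ Disjoint (tsupport f) (tsupport h) ∧ 0 < ε ∧
          ∀ β : ℝ, β₅ ≤ β → ∀ μ ∈ oddTorusLimitPoints r β, ε ≤ |Q3State G r μ (a β) f g h|) :=
  Iff.rfl

end Summit.QuantumFields.YangMills.Theorems.InfiniteVolume

end
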